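import Literature.NumberTheory.LFunctions.ConreyIwaniec2002ThetaConstant
import Literature.NumberTheory.LFunctions.ConreyIwaniec2002CircleMethodAbsorb
import Literature.NumberTheory.LFunctions.ConreyIwaniec2002BumpFourier
import Literature.NumberTheory.LFunctions.ConreyIwaniec2002KloostermanIncomplete
import Literature.NumberTheory.LFunctions.ConreyIwaniec2002ZeroDetector
import Literature.NumberTheory.LFunctions.ConreyIwaniec2002IdealNormCount
import Literature.NumberTheory.LFunctions.DirichletLOneLogBound
import Literature.NumberTheory.LFunctions.PrimitiveQuadraticCharacterModulus
import Literature.NumberTheory.Sieve.RamanujanSum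
import HarnessLib

/-!
# Conrey–Iwaniec (2002), Theorems 4.3/4.4 for the class-group theta series: the kernel compositions of SKELETON S3 and SUB-SKELETON S3d as tree theorems

B. Conrey, H. Iwaniec, *Spacing of zeros of Hecke `L`-functions and the class number problem*,
Acta Arith. 103 (2002), §§2–4 [held text `paper:arxiv-math_0111012`]. Cell `landau-siegel/ls-inputs`,
line `theta-circle-method` (SKELETON S3 v7) and sub-line `theta-voronoi` (SUB-SKELETON S3d v3).
PROVED HERE (no `sorry`, no new definition): the JOINT SUFFICIENCY of the remaining registered stubs
for the registered target S3 `ConreyIwaniec2002.stub_shifted_convolution` of SKELETON P64 (the only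
open hypothesis of the typed `conreyIwaniec2002_proposition64`, P64 v10), with every landed stub
used BY NAME (`bump_fourier` S3a, `zeroDetectorIdentity_holds` S3b1, `incomplete_kloosterman` S3b2,
`circleMethod_absorb_constants` S3f, `theta_constants` V3) and the open ones as explicit hypotheses:

* `sigma_genus_of_stubs (he1 : S3e1) (he2 : S3e2) : S3e` — genus classification + (4.27)–(4.34);
* `voronoi_theta_of_omega_hecke (hV1 : V1) (hV2 : V2) : S3d` — the transformation law of
  `θ(·;ψ)` under `ω` + Proposition 3.1 at weight one (+ V3 from the tree) give the summation datum;
* `shifted_convolution_of_stubs (hb3 : S3b3) (hc1 : S3c1) (hc2 : S3c2) (hd : S3d) (he1 : S3e1)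
  (he2 : S3e2) : S3` — the statement of `stub_shifted_convolution` VERBATIM.

CLOSING RECIPE (any seat, once the hypotheses are tree theorems):
`stub_shifted_convolution := shifted_convolution_of_stubs circle_assembly bessel_amplitude
bessel_kernel_of_amplitude (voronoi_theta_of_omega_hecke theta_omega hecke_voronoi)
genus_classification sigma_arithmetic` (names per the workers' closing files).
«The programme SEARCHES and TYPES; no claim about Landau–Siegel zeros, Theorems 1–2 of
arXiv:2211.02515 or a repaired Margin232 until a kernel theorem says so.» Nothing here proves
Proposition 6.4 or anything about `L(1,χ)`: six hypotheses remain (S3b3, S3c1, S3c2, V1, V2 via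
S3d, S3e1, S3e2), of which V1 — the `ω`-transformation law of the class-group theta series — is
the automorphic core.

## References

* [ConreyIwaniec2002] B. Conrey, H. Iwaniec, Acta Arith. 103 (2002) 259–312, arXiv:math/0111012:
  §§2–4, Theorems 4.1, 4.3, 4.4, Propositions 3.1–3.3.
-/

noncomputable section

open scoped NumberField FourierTransform
open Complex MeasureTheory

namespace Literature.NumberTheory.LFunctions

namespace ConreyIwaniec2002

open NumberField Literature.NumberTheory.LFunctions.NumberField
open Literature.Analysis.FunctionSpaces (besselJ)
open Literature.NumberTheory.Sieve (ramanujanSum)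

/-- `(6.42)`: `|λ_ψ(n)| ≤ τ(n)` for every `ψ ∈ Ĉl(K)`, `d_K = −q` (KERNEL `norm_twistCount_le`,
`idealNormCount_eq_norm_divisorSumChar_of_quadratic`, `norm_divisorSumChar_le`).
[cite: ConreyIwaniec2002, §6 (6.42)] -/
theorem norm_twistCount_le_card_divisors' {q : ℕ} [NeZero q] {χ : DirichletCharacter ℂ q}
    (hprim : χ.IsPrimitive) (hquad : χ.IsQuadratic) (hodd : χ.Odd)
    (K : Type) [Field K] [NumberField K] (h2 : Module.finrank ℚ K = 2)
    (hdisc : NumberField.discr K = -(q : ℤ)) (ψ : ClassGroup (𝓞 K) →* ℂˣ) (n : ℕ) :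
    ‖twistCount K (classGroupCharIdealHom ψ) n‖ ≤ (Nat.divisors n).card := by
  rcases Nat.eq_zero_or_pos n with hn | hn
  · subst hn; simp [twistCount_zero]
  · calc ‖twistCount K (classGroupCharIdealHom ψ) n‖ ≤ (idealNormCount K n : ℝ) :=
          norm_twistCount_le (norm_classGroupCharIdealHom_le ψ) n
      _ = ‖divisorSumChar χ n‖ :=
          idealNormCount_eq_norm_divisorSumChar_of_quadratic hprim hquad hodd K h2 hdisc hn.ne'
      _ ≤ (Nat.divisors n).card := norm_divisorSumChar_le χ n

/-- `e(x) = e(y)` when `x − y ∈ ℤ`. [folklore] -/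
private theorem fourierChar_eq_of_sub_eq_intCast {x y : ℝ} {k : ℤ} (h : x - y = k) :
    (𝐞 x : ℂ) = (𝐞 y : ℂ) := by
  have hx : x = y + k := by linarith
  rw [hx, AddChar.map_add_eq_mul, Circle.coe_mul,
    Literature.NumberTheory.Sieve.RamanujanSum.fourierChar_intCast, mul_one]

/-- An odd Dirichlet character is not trivial. [folklore] -/
private theorem ne_one_of_odd' {q : ℕ} [NeZero q] {χ : DirichletCharacter ℂ q} (hodd : χ.Odd) : χ ≠ 1 := by
  rintro rfl
  have h : ((1 : DirichletCharacter ℂ q) (-1) : ℂ) = -1 := hodd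
  rw [MulChar.one_apply (isUnit_one.neg)] at h
  norm_num at h

/-- **S3e from S3e1 + S3e2** (registered statement of `stub_sigma_genus` verbatim, the two
sub-stubs as hypotheses). [cite: ConreyIwaniec2002, §2 (2.19); §4 (4.21), (4.27)–(4.34)] -/
theorem sigma_genus_of_stubs
    (he1 :
    ∀ (q : ℕ) [NeZero q], 4 < q → Odd q → ∀ χ : DirichletCharacter ℂ q,
      χ.IsPrimitive → χ.IsQuadratic → χ.Odd →
        ∀ (K : Type) [Field K] [NumberField K],
          Module.finrank ℚ K = 2 → NumberField.discr K = -(q : ℤ) →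
            ∀ (ψ : ClassGroup (𝓞 K) →* ℂˣ),
              (∀ c : ℕ, voronoiMainCoeff q ‖χ.LFunction 1‖ ψ c = 0) ∨
                ∃ v w : ℕ, v * w = q ∧
                  ∀ c : ℕ, voronoiMainCoeff q ‖χ.LFunction 1‖ ψ c =
                    genusSigmaCoeff q ‖χ.LFunction 1‖ v w c)
    (he2 :
    ∀ (q : ℕ), Squarefree q → ∀ (v w : ℕ), v * w = q → ∀ (ℓ : ℝ), 0 ≤ ℓ →
      IsCISigma q ℓ (ciSigma (genusSigmaCoeff q ℓ v w))) :
    ∀ (q : ℕ) [NeZero q], 4 < q → Odd q → ∀ χ : DirichletCharacter ℂ q,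
      χ.IsPrimitive → χ.IsQuadratic → χ.Odd →
        ∀ (K : Type) [Field K] [NumberField K],
          Module.finrank ℚ K = 2 → NumberField.discr K = -(q : ℤ) →
            ∀ (ψ : ClassGroup (𝓞 K) →* ℂˣ),
              IsCISigma q ‖χ.LFunction 1‖
                (ciSigma (voronoiMainCoeff q ‖χ.LFunction 1‖ ψ)) := by
  intro q _ hq hodd χ hprim hquad hoddχ K _ _ h2 hdisc ψ
  rcases he1 q hq hodd χ hprim hquad hoddχ K h2 hdisc ψ with h0 | ⟨v, w, hvw, hp⟩
  · -- non-real `ψ`: `p ≡ 0`, `σ ≡ 0`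
    have hσ : ciSigma (voronoiMainCoeff q ‖χ.LFunction 1‖ ψ) = 0 := by
      funext h
      simp only [ciSigma, h0, Pi.zero_apply]
      simp
    rw [hσ]
    refine ⟨fun h _ ↦ ?_, Or.inl rfl⟩
    simp only [Pi.zero_apply, abs_zero]
    exact mul_nonneg (mul_nonneg (by norm_num) (sq_nonneg _))
      (Finset.sum_nonneg fun d _ ↦ inv_nonneg.mpr (Nat.cast_nonneg d))
  · -- `ψ` the genus character of `{v, w}`
    have hpf : voronoiMainCoeff q ‖χ.LFunction 1‖ ψ = genusSigmaCoeff q ‖χ.LFunction 1‖ v w :=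
      funext hp
    rw [hpf]
    exact he2 q
      (Literature.NumberTheory.LFunctions.PrimitiveQuadratic.squarefree_of_isPrimitive_of_isQuadratic
        hodd hprim hquad) v w hvw _ (norm_nonneg _)

/-- **S3d from V1 + V2 (+ V3 in the tree)** (registered statement of `stub_voronoi_theta` verbatim).
[cite: ConreyIwaniec2002, Proposition 3.2 (3.14), Proposition 3.3 (3.21), §4 (4.21)] -/
theorem voronoi_theta_of_omega_hecke
    (hV1 :
    ∀ (q : ℕ) [NeZero q], 4 < q → Odd q → ∀ χ : DirichletCharacter ℂ q,
      χ.IsPrimitive → χ.IsQuadratic → χ.Odd →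
        ∀ (K : Type) [Field K] [NumberField K],
          Module.finrank ℚ K = 2 → NumberField.discr K = -(q : ℤ) →
            ∀ (ψ : ClassGroup (𝓞 K) →* ℂˣ) (c : ℕ), 1 ≤ c →
              ∃ ψ' : ClassGroup (𝓞 K) →* ℂˣ, IsGenusCharFor (ψ' * ψ⁻¹) (Nat.gcd c q) ∧
                ∀ a abar : ℤ, a * abar ≡ 1 [ZMOD c] →
                  ∃ η : ℂ, ‖η‖ = 1 ∧
                    IsOmegaRelated ((c : ℝ) * Real.sqrt (q / Nat.gcd c q : ℕ)) η
                      (twistCount K (classGroupCharIdealHom ψ))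
                      (twistCount K (classGroupCharIdealHom ψ'))
                      (thetaConst K ψ) (thetaConst K ψ')
                      ((a : ℝ) / c)
                      (-((abar * ((((q / Nat.gcd c q : ℕ) : ZMod c)⁻¹).val : ℤ) : ℤ) : ℝ) / c))
    (hV2 : HeckeVoronoiWeightOne) :
    ∀ (q : ℕ) [NeZero q], 4 < q → Odd q → ∀ χ : DirichletCharacter ℂ q,
      χ.IsPrimitive → χ.IsQuadratic → χ.Odd →
        ∀ (K : Type) [Field K] [NumberField K],
          Module.finrank ℚ K = 2 → NumberField.discr K = -(q : ℤ) →
            ∀ (ψ : ClassGroup (𝓞 K) →* ℂˣ),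
              ∃ (u : ℕ → ℤ → ℂ) (φ : ℕ → ℕ → ℂ),
                IsVoronoiDatum (2 * Real.pi + Real.sqrt q * ‖χ.LFunction 1‖)
                  (twistCount K (classGroupCharIdealHom ψ))
                  (ciBesselKernel fun c ↦ q / Nat.gcd c q)
                  (voronoiMainCoeff q ‖χ.LFunction 1‖ ψ) u φ
                  (fun c m ↦ -(((((q / Nat.gcd c q : ℕ) : ZMod c)⁻¹).val : ℤ) * m)) := by
  intro q _ hq hodd χ hprim hquad hoddχ K _ _ h2 hdisc ψ
  classical
  set ℓ : ℝ := ‖χ.LFunction 1‖ with hℓ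
  -- V1 with choice: `ψ'_c` and `η_{c,a,ā}`
  have hV1 := hV1 q hq hodd χ hprim hquad hoddχ K h2 hdisc ψ
  choose Ψ hΨg hΨ using hV1
  choose η hηn hηr using hΨ
  -- the canonical inverse `ā₀` of `a` modulo `c`
  set ab : ℕ → ℤ → ℤ := fun c a ↦ ((((a : ZMod c)⁻¹).val : ℕ) : ℤ) with hab
  set u : ℕ → ℤ → ℂ := fun c a ↦
    if h : 1 ≤ c ∧ a * ab c a ≡ 1 [ZMOD c] then I * η c h.1 a (ab c a) h.2 else 1 with hu
  set φ : ℕ → ℕ → ℂ := fun c m ↦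
    if h : 1 ≤ c then
      ((2 * Real.pi / ((c : ℝ) * Real.sqrt (q / Nat.gcd c q : ℕ)) : ℝ) : ℂ) *
        twistCount K (classGroupCharIdealHom (Ψ c h)) m
    else 0 with hφ
  refine ⟨u, φ, ?_⟩
  intro c hc
  have hc0 : (0 : ℝ) < c := by exact_mod_cast hc
  haveI : NeZero c := ⟨by omega⟩
  set s : ℕ := Nat.gcd c q with hs
  set r : ℕ := q / Nat.gcd c q with hr
  have hq0 : 0 < q := by omega
  have hs0 : 0 < s := Nat.gcd_pos_of_pos_right c hq0
  have hsq : s ≤ q := by rw [hs]; exact Nat.le_of_dvd hq0 (Nat.gcd_dvd_right c q)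
  have hr1 : 1 ≤ r := (Nat.one_le_div_iff hs0).mpr hsq
  have hr1R : (1 : ℝ) ≤ r := by exact_mod_cast hr1
  have hsqrt_r : 1 ≤ Real.sqrt r := by rw [← Real.sqrt_one]; exact Real.sqrt_le_sqrt hr1R
  have hsqrt_r0 : 0 < Real.sqrt r := by linarith
  have hℓ0 : 0 ≤ ℓ := norm_nonneg _
  have hA0 : 0 < 2 * Real.pi + Real.sqrt q * ℓ := by
    have : 0 ≤ Real.sqrt q * ℓ := by positivity
    linarith [Real.pi_pos]
  refine ⟨?_, ?_, ?_, ?_⟩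
  · -- `0 ≤ p(c)`
    unfold voronoiMainCoeff
    exact Set.indicator_nonneg (fun _ _ ↦ by positivity) _
  · -- `p(c) ≤ A/c`
    unfold voronoiMainCoeff
    refine Set.indicator_apply_le' (fun _ ↦ ?_) (fun _ ↦ by positivity)
    rw [div_le_div_iff_of_pos_right hc0]
    have h1 : Real.sqrt (Nat.gcd c q : ℕ) ≤ Real.sqrt q := Real.sqrt_le_sqrt (by exact_mod_cast hsq)
    have h2 : Real.sqrt (Nat.gcd c q : ℕ) * ℓ ≤ Real.sqrt q * ℓ := mul_le_mul_of_nonneg_right h1 hℓ0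
    linarith [Real.pi_pos]
  · -- `|φ_c(m)| ≤ Aτ(m)/c`
    intro m hm
    simp only [hφ, dif_pos hc]
    rw [norm_mul, Complex.norm_real, Real.norm_eq_abs, abs_of_nonneg (by positivity)]
    have hlam := norm_twistCount_le_card_divisors' hprim hquad hoddχ K h2 hdisc (Ψ c hc) m
    have hτ0 : (0 : ℝ) ≤ (Nat.divisors m).card := Nat.cast_nonneg _
    calc 2 * Real.pi / ((c : ℝ) * Real.sqrt r) * ‖twistCount K (classGroupCharIdealHom (Ψ c hc)) m‖
        ≤ 2 * Real.pi / ((c : ℝ) * Real.sqrt r) * (Nat.divisors m).card :=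
          mul_le_mul_of_nonneg_left hlam (by positivity)
      _ = (2 * Real.pi / Real.sqrt r) * (Nat.divisors m).card / c := by
          field_simp
      _ ≤ (2 * Real.pi + Real.sqrt q * ℓ) * (Nat.divisors m).card / c := by
          rw [div_le_div_iff_of_pos_right hc0]
          refine mul_le_mul_of_nonneg_right ?_ hτ0
          have h3 : 2 * Real.pi / Real.sqrt r ≤ 2 * Real.pi := div_le_self (by positivity) hsqrt_r
          have h4 : 0 ≤ Real.sqrt q * ℓ := by positivity
          linarith
  · -- the summation formula at `a/c`
    intro a abar hab1
    -- `a` is a unit mod `c`; `ā₀` is an inverse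
    have hmul : (a : ZMod c) * (abar : ZMod c) = 1 := by
      have h1 := (ZMod.intCast_eq_intCast_iff (a := a * abar) (b := 1) (c := c)).mpr hab1
      push_cast at h1
      exact h1
    have hunit : IsUnit (a : ZMod c) := IsUnit.of_mul_eq_one _ hmul
    have hab0 : ((ab c a : ℤ) : ZMod c) = (a : ZMod c)⁻¹ := by
      simp only [hab, Int.cast_natCast, ZMod.natCast_zmod_val]
    have hco : a * ab c a ≡ 1 [ZMOD c] := by
      rw [← ZMod.intCast_eq_intCast_iff]
      push_cast
      rw [hab0, ZMod.mul_inv_of_unit _ hunit]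
    have hu_eq : u c a = I * η c hc a (ab c a) hco := by
      simp only [hu, dif_pos (And.intro hc hco)]
    refine ⟨by rw [hu_eq, norm_mul, Complex.norm_I, hηn, one_mul], ?_⟩
    intro g hg hsupp
    -- V2 at `(a, ā₀)`
    set η₀ : ℂ := η c hc a (ab c a) hco with hη₀
    have hη₀n : ‖η₀‖ = 1 := hηn c hc a (ab c a) hco
    have hη₀0 : η₀ ≠ 0 := fun h ↦ by simp [h] at hη₀n
    have hrel := hηr c hc a (ab c a) hco
    have hlamA : ∀ n : ℕ, ‖twistCount K (classGroupCharIdealHom ψ) n‖ ≤ 1 * (Nat.divisors n).card :=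
      fun n ↦ by
        rw [one_mul]
        exact norm_twistCount_le_card_divisors' hprim hquad hoddχ K h2 hdisc ψ n
    have hlamB : ∀ n : ℕ,
        ‖twistCount K (classGroupCharIdealHom (Ψ c hc)) n‖ ≤ 1 * (Nat.divisors n).card :=
      fun n ↦ by
        rw [one_mul]
        exact norm_twistCount_le_card_divisors' hprim hquad hoddχ K h2 hdisc (Ψ c hc) n
    have hHS := hV2 c r hc hr1 η₀ hη₀0 1 _ _ hlamA hlamB (thetaConst K ψ)
      (thetaConst K (Ψ c hc)) _ _ hrel g hg hsupp
    -- V3: the leading constant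
    have hmain := theta_constants q hq hodd χ hprim hquad hoddχ K h2 hdisc ψ (Ψ c hc) c hc
      (hΨg c hc)
    -- rewrite the target into the shape delivered by V2
    set rbar : ℤ := ((((q / Nat.gcd c q : ℕ) : ZMod c)⁻¹).val : ℤ) with hrbar
    -- `ā₀ ≡ ā (mod c)`
    have hdiff : (c : ℤ) ∣ (ab c a - abar) := by
      have h1 : ((ab c a : ℤ) : ZMod c) = (abar : ZMod c) := by
        rw [hab0]
        calc (a : ZMod c)⁻¹ = (a : ZMod c)⁻¹ * ((a : ZMod c) * (abar : ZMod c)) := by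
              rw [hmul, mul_one]
          _ = (abar : ZMod c) := by
              rw [← mul_assoc, ZMod.inv_mul_of_unit _ hunit, one_mul]
      exact (ZMod.intCast_eq_intCast_iff_dvd_sub _ _ _).mp h1.symm
    obtain ⟨k, hk⟩ := hdiff
    have hk' : ((ab c a : ℤ) : ℝ) - (abar : ℝ) = (c : ℝ) * (k : ℝ) := by exact_mod_cast hk
    have hc' : (c : ℝ) ≠ 0 := hc0.ne'
    -- the phases `e(ā·(−r̄(m+1))/c) = e((m+1)·(−ā₀r̄/c))`
    have hph : ∀ m : ℕ,
        (𝐞 (((abar * -(rbar * ((m + 1 : ℕ) : ℤ)) : ℤ) : ℝ) / c) : ℂ) =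
          (𝐞 (((m : ℝ) + 1) * (-((ab c a * rbar : ℤ) : ℝ) / c)) : ℂ) := by
      intro m
      refine fourierChar_eq_of_sub_eq_intCast (k := k * rbar * ((m + 1 : ℕ) : ℤ)) ?_
      push_cast
      field_simp
      linear_combination ((rbar : ℝ)) * hk'
    -- the target, written out
    have key : HasSum
        (fun m : ℕ ↦ u c a * φ c (m + 1) *
          (𝐞 (((abar * -(rbar * ((m + 1 : ℕ) : ℤ)) : ℤ) : ℝ) / c) : ℂ) *
          ∫ x in Set.Ioi (0 : ℝ), g x * ciBesselKernel (fun c ↦ q / Nat.gcd c q) c (m + 1) x)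
        ((∑' n : ℕ, twistCount K (classGroupCharIdealHom ψ) n * (𝐞 ((a : ℝ) * n / c) : ℂ) * g n) -
          u c a * (voronoiMainCoeff q ℓ ψ c : ℂ) * ∫ x in Set.Ioi (0 : ℝ), g x) := by
      convert hHS using 1
      · funext m
        have hker : (fun x ↦ g x * ciBesselKernel (fun c ↦ q / Nat.gcd c q) c (m + 1) x) =
            (fun x ↦ g x * ciBesselKernel (fun _ ↦ r) c (m + 1) x) := rfl
        rw [hker, hph m, hu_eq]
        simp only [hφ, dif_pos hc]
        push_cast
        field_simp
        ring
      · have hsum : (fun n : ℕ ↦ twistCount K (classGroupCharIdealHom ψ) n *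
              (𝐞 ((a : ℝ) * n / c) : ℂ) * g n) =
            (fun n : ℕ ↦ twistCount K (classGroupCharIdealHom ψ) n *
              (𝐞 ((n : ℝ) * ((a : ℝ) / c)) : ℂ) * g n) := by
          funext n
          rw [show ((a : ℝ) * n / c) = (n : ℝ) * ((a : ℝ) / c) by ring]
        rw [hsum, hu_eq]
        congr 1
        rw [← hr] at hmain
        rw [← hmain]
        push_cast
        field_simp
    exact key


/-- **THEOREMS 4.3/4.4 FOR `λ_ψ` FROM THE OPEN STUBS** — the kernel composition of SKELETON S3 with
the landed stubs by name; the conclusion is VERBATIM the registered S3 `stub_shifted_convolution`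
of SKELETON P64. [cite: ConreyIwaniec2002, Theorem 4.3 (4.25), Theorem 4.4 (4.26)] -/
theorem shifted_convolution_of_stubs
    (hb3 :
    ∀ (c₁ K₀ : ℝ), 0 < c₁ → 0 < K₀ → BumpFourierDecay c₁ → ZeroDetectorIdentity →
      IncompleteKloostermanBound K₀ → ∃ c₀ : ℝ, 0 < c₀ ∧ CircleMethodBound c₀)
    (hc1 : ∃ C_W : ℝ, 0 < C_W ∧ BesselJZeroAmplitude C_W)
    (hc2 :
    ∀ C_W : ℝ, 0 < C_W → BesselJZeroAmplitude C_W →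
      ∃ B₀ : ℝ, 1 ≤ B₀ ∧ ∀ (q : ℕ), 1 ≤ q → ∀ r : ℕ → ℕ, (∀ c : ℕ, 1 ≤ r c ∧ r c ≤ q) →
        KernelFourierBound q (B₀ * (q : ℝ) ^ (3 / 2 : ℝ)) (ciBesselKernel r))
    (hd :
    ∀ (q : ℕ) [NeZero q], 4 < q → Odd q → ∀ χ : DirichletCharacter ℂ q,
      χ.IsPrimitive → χ.IsQuadratic → χ.Odd →
        ∀ (K : Type) [Field K] [NumberField K],
          Module.finrank ℚ K = 2 → NumberField.discr K = -(q : ℤ) →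
            ∀ (ψ : ClassGroup (𝓞 K) →* ℂˣ),
              ∃ (u : ℕ → ℤ → ℂ) (φ : ℕ → ℕ → ℂ),
                IsVoronoiDatum (2 * Real.pi + Real.sqrt q * ‖χ.LFunction 1‖)
                  (twistCount K (classGroupCharIdealHom ψ))
                  (ciBesselKernel fun c ↦ q / Nat.gcd c q)
                  (voronoiMainCoeff q ‖χ.LFunction 1‖ ψ) u φ
                  (fun c m ↦ -(((((q / Nat.gcd c q : ℕ) : ZMod c)⁻¹).val : ℤ) * m)))
    (he1 :
    ∀ (q : ℕ) [NeZero q], 4 < q → Odd q → ∀ χ : DirichletCharacter ℂ q,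
      χ.IsPrimitive → χ.IsQuadratic → χ.Odd →
        ∀ (K : Type) [Field K] [NumberField K],
          Module.finrank ℚ K = 2 → NumberField.discr K = -(q : ℤ) →
            ∀ (ψ : ClassGroup (𝓞 K) →* ℂˣ),
              (∀ c : ℕ, voronoiMainCoeff q ‖χ.LFunction 1‖ ψ c = 0) ∨
                ∃ v w : ℕ, v * w = q ∧
                  ∀ c : ℕ, voronoiMainCoeff q ‖χ.LFunction 1‖ ψ c =
                    genusSigmaCoeff q ‖χ.LFunction 1‖ v w c)
    (he2 :
    ∀ (q : ℕ), Squarefree q → ∀ (v w : ℕ), v * w = q → ∀ (ℓ : ℝ), 0 ≤ ℓ →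
      IsCISigma q ℓ (ciSigma (genusSigmaCoeff q ℓ v w))) :
    ∃ c : ℝ, 0 < c ∧
      ∀ (q : ℕ) [NeZero q], 4 < q → Odd q → ∀ χ : DirichletCharacter ℂ q,
        χ.IsPrimitive → χ.IsQuadratic → χ.Odd →
          ∀ (K : Type) [Field K] [NumberField K],
            Module.finrank ℚ K = 2 → NumberField.discr K = -(q : ℤ) →
              ∀ (ψ : ClassGroup (𝓞 K) →* ℂˣ),
                ∃ σ : ℕ → ℝ, IsCISigma q ‖χ.LFunction 1‖ σ ∧
                  ShiftedConvolutionBound (twistCount K (classGroupCharIdealHom ψ)) σ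
                    (c * (q : ℝ) ^ (6 : ℕ)) := by
  obtain ⟨c₁, hc₁, hF⟩ := bump_fourier
  obtain ⟨K₀, hK₀, hK⟩ := incomplete_kloosterman
  obtain ⟨c₀, hc₀, hCM⟩ := hb3 c₁ K₀ hc₁ hK₀ hF zeroDetectorIdentity_holds hK
  obtain ⟨C_W, hCW, hW⟩ := hc1
  obtain ⟨B₀, hB₀, hKer⟩ := hc2 C_W hCW hW
  obtain ⟨c, hc, habs⟩ := circleMethod_absorb_constants c₀ B₀ hc₀ hB₀
  refine ⟨c, hc, ?_⟩
  intro q _ hq hodd χ hprim hquad hoddχ K _ _ h2 hdisc ψ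
  set ℓ : ℝ := ‖χ.LFunction 1‖ with hℓ
  set lam : ℕ → ℂ := twistCount K (classGroupCharIdealHom ψ) with hlam
  set p : ℕ → ℝ := voronoiMainCoeff q ℓ ψ with hp
  set rr : ℕ → ℕ := fun c ↦ q / Nat.gcd c q with hrr
  -- S3d: the summation datum; S3e: the main-term coefficients are admissible
  obtain ⟨u, φ, hV⟩ := hd q hq hodd χ hprim hquad hoddχ K h2 hdisc ψ
  refine ⟨ciSigma p, (sigma_genus_of_stubs he1 he2 q hq hodd χ hprim hquad hoddχ K h2 hdisc ψ), ?_⟩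
  intro X hX g₁ g₂ hg₁ hg₂ h hh
  -- numerics
  have hq5 : (5 : ℝ) ≤ q := by exact_mod_cast hq
  have hq2 : 2 ≤ q := by omega
  have hq1 : 1 ≤ q := by omega
  have hℓ0 : 0 ≤ ℓ := norm_nonneg _
  have hℓlog : ℓ ≤ Real.log q := DirichletAbel.norm_LFunction_one_le_log χ (ne_one_of_odd' hoddχ)
  have hA : 1 ≤ 2 * Real.pi + Real.sqrt q * ℓ := by
    have : 0 ≤ Real.sqrt q * ℓ := by positivity
    linarith [Real.pi_gt_three]
  have hB : 1 ≤ B₀ * (q : ℝ) ^ (3 / 2 : ℝ) := by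
    have h1 : (1 : ℝ) ≤ (q : ℝ) ^ (3 / 2 : ℝ) := Real.one_le_rpow (by linarith) (by norm_num)
    nlinarith
  -- S3c: (4.5) for the Bessel kernels with `r = q/(c,q)`
  have hrr1 : ∀ c : ℕ, 1 ≤ rr c ∧ rr c ≤ q := by
    intro c
    refine ⟨?_, Nat.div_le_self q _⟩
    have hg : 0 < Nat.gcd c q := Nat.gcd_pos_of_pos_right c (by omega)
    exact (Nat.one_le_div_iff hg).mpr (Nat.le_of_dvd (by omega) (Nat.gcd_dvd_right c q))
  have hK := hKer q hq1 rr hrr1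
  -- S3b: the circle method
  have hmain := hCM q hq2 _ _ hA hB lam (ciBesselKernel rr) p u φ _ hV hK X hX g₁ g₂ hg₁ hg₂ h hh
  -- S3f: absorption
  have hfin := habs q X ℓ hq5 hX hℓ0 hℓlog
  have hτ : (0 : ℝ) ≤ (Nat.divisors h).card := Nat.cast_nonneg _
  calc ‖(∑ n ∈ Finset.Icc 1 ⌊2 * X⌋₊,
            lam (n + h) * starRingEnd ℂ (lam n) * g₁ ((n : ℝ) + h) * g₂ n) -
          (ciSigma p h : ℂ) * ∫ x : ℝ, g₁ (x + h) * g₂ x‖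
      ≤ c₀ * (Nat.divisors h).card * (2 * Real.pi + Real.sqrt q * ℓ) ^ 2 *
          (X / Real.sqrt (q * X) +
            q * (B₀ * (q : ℝ) ^ (3 / 2 : ℝ)) ^ 2 * ((q : ℝ) * X) ^ (3 / 4 : ℝ) *
              (1 + Real.log (q * X)) ^ 2) := hmain
    _ = (Nat.divisors h).card * (c₀ * (2 * Real.pi + Real.sqrt q * ℓ) ^ 2 *
          (X / Real.sqrt (q * X) +
            q * (B₀ * (q : ℝ) ^ (3 / 2 : ℝ)) ^ 2 * ((q : ℝ) * X) ^ (3 / 4 : ℝ) *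
              (1 + Real.log (q * X)) ^ 2)) := by ring
    _ ≤ (Nat.divisors h).card * (c * (q : ℝ) ^ (6 : ℕ) * X ^ (3 / 4 : ℝ) * Real.log (3 * X) ^ 2) :=
        mul_le_mul_of_nonneg_left hfin hτ
    _ = c * (q : ℝ) ^ (6 : ℕ) * (Nat.divisors h).card * X ^ (3 / 4 : ℝ) * Real.log (3 * X) ^ 2 := by
        ring


end ConreyIwaniec2002

end Literature.NumberTheory.LFunctions

end
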